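import Summits.Ventures.Crystal3D.Theorems.StickyWulffConstantCoaxialWallLawEndRowCoaxialModuleDefs
import HarnessLib

/-!
# The JOINT (two-frame, six-root) basal end row — the census object F_layer needs (T-F2, memo n3 §3 (L4a); cf-p1 DECISION (lxxx))

HONEST FRAMING. Venture `Summits/Ventures/Crystal3D` (cell `crystal3d-full`); DEFINITIONS ONLY for the crux `CoaxialWallLaw`
(stmt-Ventures-19481, lane F) in its role as owner of lane T's debt T-F2 = `stub_famFaulted` (TexShadow v7, crux `TextureLiminfV5`).
Census-free, standard axioms; nothing is claimed about the rows; F-C1 not moved.  WHY (sizing memo HOME/wall-19481-p1/T-F2-n3.md §3,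
cf-p1 (lxxx)): a FAULTED plate presented with frame `L` launches F-type walkers of BOTH its bilayer frames `L` and `H·L` (`H` = the
half-turn about the model stacking axis; strips alternate), and the facing plate absorbs/launches with the same two frames; the landed
rows (`EndRowTransA` = one frame, `EndRowTwinHalfTurnA` = `L` rising + `H·L` falling, three-slot sectors) bound the load of ONE such
frame pair, while F_layer's per-strip ledger pools ALL FOUR systems {L, H·L} × {rising, falling} on the same payers.  This file names
that pooled row and its certificate target, on existing vocabulary only (no new structure):

* `basalSystem L` — the plate system `⟨L, basalHexagon⟩` (all six in-plane model slots as roots = rising ∪ falling for every wall);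
* **`EndRowJointA v s_F`** — `∀ L, LocalEndRowA v s_F (basalSystem L) (basalSystem (H·L))`: the JOINT kernel row;
* `jointSigs` — the twelve signatures `{false, true} × basalHexagon` (⊇ `transSigs ε e₃`-hexagon part, ⊇ every `twinSigs ε h`);
* **`EndRowOnSiteJointFlatA v s_F 𝒰`** — the certificate target: `∀ P ∈ 𝒰, localStatSigFlat P v jointSigs 0 ≤ s_F` (lit's 'bnb-joint'
  over `coaxialModuleUniverse`), + the non-flat `EndRowOnSiteJointA`, + `EndRowJointTailA` (the off-module tail of the joint row);
* monotonicity in `s_F` and in the universe (one-liners, as for the rows of record).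
INSTANCE OF RECORD (cf-p1 DECISION (lxxxiii)): the kernel row `EndRowJointA WordVersion.v2 (2 * √6)`, to be obtained — exactly like the
rows of record — from the CERTIFICATE `EndRowOnSiteJointFlatA v2 (2√6) coaxialModuleUniverse` (owner cf-p2, 'jointrow'; universe = 𝒰_cx,
the same on-site/off-module split as lane F: the strips of a twin-family pair see module windows) + the off-module tail
`EndRowJointTailA v2 (2√6) coaxialModuleUniverse` + a `jointSigs`-dominate bridge (19481-p2, after T1–T4).  NUMBERS SO FAR (19481-p1 g14
(N), kit j322198, cf-p2's kernel-literal engine, v2(A), pooling radius 1): over all 20 class words with ≤ 2 vacancies the joint statistic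
peaks at `922/315 = 2.927` ≪ `2√6 = 4.899` (single-frame rows on the same windows reach `293/70` — on INCLINED planes, which the joint row
never pools); |V| = 3 + co-loading table: kit j322366 (the certificate's pilot).
WHAT THIS IS NOT: no certificate, no bridge `EndRowOnSiteJointFlatA → EndRowJointA` (needs the signature-dominate lemma for `jointSigs`, the
analogue of p681542/p681893), no tail theorem; F-C1 not moved.
-/

noncomputable section

namespace Summit.Ventures.Crystal3D.Theorems

open Summit.Ventures.Crystal3D Finset
open scoped InnerProductSpace

/-! ### The joint kernel row -/

/-- The BASAL plate system of the frame `L`: all six in-plane model slots as roots (rising ∪ falling ∪ level, for any wall normal). -/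
def basalSystem (L : EuclideanSpace ℝ (Fin 3) ≃ₗᵢ[ℝ] EuclideanSpace ℝ (Fin 3)) : PlateSystem := ⟨L, basalHexagon⟩

/-- **THE JOINT BASAL END ROW** at version `v` with constant `s_F`: for every frame `L`, the (A) local row for the pair of plate
systems `⟨L, basalHexagon⟩`, `⟨H·L, basalHexagon⟩` (`H` = the half-turn about the model axis `e₃`) — both bilayer frames of a
faulted plate, rising AND falling roots, pooled on the same payers. -/
def EndRowJointA (v : WordVersion) (sF : ℝ) : Prop :=
  ∀ L : EuclideanSpace ℝ (Fin 3) ≃ₗᵢ[ℝ] EuclideanSpace ℝ (Fin 3),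
    LocalEndRowA v sF (basalSystem L)
      (basalSystem (((ℝ ∙ EuclideanSpace.single (2 : Fin 3) (1 : ℝ)).reflection).trans L))

/-! ### The joint signature set and the certificate target -/

open scoped Classical in
/-- **JOINT ROW SIGNATURES**: the twelve classes `(ε, w)`, `ε ∈ {false, true}` (dozens `D₊`, `D₋`), `w` a basal model slot. -/
def jointSigs : Finset (Bool × EuclideanSpace ℝ (Fin 3)) :=
  basalHexagon.image (fun w => (false, w)) ∪ basalHexagon.image fun w => (true, w)

/-- `transSigs ε n` restricted to basal slots lies in `jointSigs` (in particular `transSigs ε e₃`'s hexagon part). -/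
theorem mem_jointSigs_of_basal {ε : Bool} {w : EuclideanSpace ℝ (Fin 3)} (hw : w ∈ basalHexagon) : (ε, w) ∈ jointSigs := by
  unfold jointSigs
  rcases ε with _ | _
  · exact mem_union_left _ (mem_image.2 ⟨w, hw, rfl⟩)
  · exact mem_union_right _ (mem_image.2 ⟨w, hw, rfl⟩)

/-- Every twin-row signature set lies in `jointSigs`. -/
theorem twinSigs_subset_jointSigs (ε : Bool) (h : EuclideanSpace ℝ (Fin 3)) : twinSigs ε h ⊆ jointSigs := by
  intro σ hσ
  unfold twinSigs at hσ
  rcases mem_union.1 hσ with h1 | h2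
  · obtain ⟨w, hw, rfl⟩ := mem_image.1 h1
    exact mem_jointSigs_of_basal (mem_filter.1 hw).1
  · obtain ⟨w, hw, rfl⟩ := mem_image.1 h2
    have hwb : w ∈ basalHexagon := (mem_filter.1 hw).1
    refine mem_jointSigs_of_basal ?_
    unfold basalHexagon at hwb ⊢
    obtain ⟨hwS, hw0⟩ := mem_filter.1 hwb
    exact mem_filter.2 ⟨neg_mem_fccSlots hwS, by rw [PiLp.neg_apply, hw0, neg_zero]⟩

/-- **THE JOINT ON-SITE FACT, FLAT FORM** (certificate target 'bnb-joint'): for every pattern of `𝒰`, the flat local statistic of the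
joint signatures at the payer `0` is `≤ s_F`. -/
def EndRowOnSiteJointFlatA (v : WordVersion) (sF : ℝ) (𝒰 : Set (Finset (EuclideanSpace ℝ (Fin 3)))) : Prop :=
  ∀ P ∈ 𝒰, localStatSigFlat P v jointSigs 0 ≤ sF

/-- The joint on-site fact, non-flat form. -/
def EndRowOnSiteJointA (v : WordVersion) (sF : ℝ) (𝒰 : Set (Finset (EuclideanSpace ℝ (Fin 3)))) : Prop :=
  ∀ P ∈ 𝒰, localStatSig P v jointSigs 0 ≤ sF

open scoped Classical in
/-- **THE JOINT TAIL**: at every payer window NOT on-site for `𝒰`, the summand of the joint row is `≤ s_F`, for every frame. -/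
def EndRowJointTailA (v : WordVersion) (sF : ℝ) (𝒰 : Set (Finset (EuclideanSpace ℝ (Fin 3)))) : Prop :=
  ∀ L : EuclideanSpace ℝ (Fin 3) ≃ₗᵢ[ℝ] EuclideanSpace ℝ (Fin 3),
  ∀ X : Finset (EuclideanSpace ℝ (Fin 3)), (∀ p ∈ X, ∀ q ∈ X, p ≠ q → 1 ≤ dist p q) →
  ∀ z ∈ X, (X.filter fun q => dist z q = 1).card ≤ 11 → ¬ OnSiteAt 𝒰 X z →
    localSummandA v (basalSystem L) (basalSystem (((ℝ ∙ EuclideanSpace.single (2 : Fin 3) (1 : ℝ)).reflection).trans L)) X z ≤ sF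

/-! ### Monotonicity -/

/-- The joint row is monotone in the constant. -/
theorem endRowJointA_mono_const {v : WordVersion} {s s' : ℝ} (hs : s ≤ s') (h : EndRowJointA v s) : EndRowJointA v s' :=
  fun L X hX z hz hdeg => (h L X hX z hz hdeg).trans hs

/-- The flat joint on-site fact is monotone in the constant. -/
theorem endRowOnSiteJointFlatA_mono_const {v : WordVersion} {s s' : ℝ} {𝒰 : Set (Finset (EuclideanSpace ℝ (Fin 3)))}
    (hs : s ≤ s') (h : EndRowOnSiteJointFlatA v s 𝒰) : EndRowOnSiteJointFlatA v s' 𝒰 :=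
  fun P hP => (h P hP).trans hs

/-- The flat joint on-site fact over a larger universe is stronger. -/
theorem endRowOnSiteJointFlatA_anti {v : WordVersion} {sF : ℝ} {𝒰 𝒰' : Set (Finset (EuclideanSpace ℝ (Fin 3)))}
    (h𝒰 : 𝒰 ⊆ 𝒰') (h : EndRowOnSiteJointFlatA v sF 𝒰') : EndRowOnSiteJointFlatA v sF 𝒰 :=
  fun P hP => h P (h𝒰 hP)

/-- The joint tail over a larger universe is weaker. -/
theorem endRowJointTailA_mono {v : WordVersion} {sF : ℝ} {𝒰 𝒰' : Set (Finset (EuclideanSpace ℝ (Fin 3)))} (h𝒰 : 𝒰 ⊆ 𝒰')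
    (ht : EndRowJointTailA v sF 𝒰) : EndRowJointTailA v sF 𝒰' :=
  fun L X hX z hz hdeg hoff => ht L X hX z hz hdeg fun hon => hoff (by
    obtain ⟨P, hP, S, hS⟩ := hon
    exact ⟨P, h𝒰 hP, S, hS⟩)

/-- **Decomposition** (as for the rows of record): the on-site case for 𝒰 plus the tail give the joint row — stated as the
target shape of the future bridge (the on-site case needs the `jointSigs`-dominate lemma; here only the trivial direction
«row ⇒ tail» is recorded). -/
theorem endRowJointTailA_of_row {v : WordVersion} {sF : ℝ} (𝒰 : Set (Finset (EuclideanSpace ℝ (Fin 3)))) (h : EndRowJointA v sF) :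
    EndRowJointTailA v sF 𝒰 :=
  fun L X hX z hz hdeg _ => h L X hX z hz hdeg

end Summit.Ventures.Crystal3D.Theorems

end
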